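import Literature.AnabelianGeometry.EtaleTheta.ContH1Injectivity

/-!
# Restriction in degree one is injective when the subgroup has no fixed points on the coefficients

Support lemma (PROVED, no named facts) for the continuous first cohomology `ContH1` of
`ContH1.lean` (abc-iut-L2-t1): the degree-one inflation–restriction sequence
`0 → H¹(H/N, A^N) → H¹(H, A) → H¹(N, A)` ([cite: NeukirchSchmidtWingberg2008, I §6]) shows that
restriction to a normal subgroup `N ⊴ H` is INJECTIVE as soon as `A^N = 1`. This file proves that
corollary directly on crossed homomorphisms (no quotient group, no continuity hypothesis on `φ`):
if a continuous cocycle `f` of `H` restricts to the coboundary of `a` on `N`, then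
`h ↦ a · f(h) · (ʰa)⁻¹` is fixed by `N`, hence trivial, so `f` is the coboundary of `a` on `H`.

Use in the abc-iut cell (layer L6 ↔ L2 junction, [IUTchII] Cor. 1.12 (ii), kurims p. 57): the
"natural inclusion" of `lim_J H¹(J, (l·Δ_Θ)(Π))` into `lim_J H¹(Π_Ÿ(Π)|_J, (l·Δ_Θ)(Π))` is level-wise the
restriction to the open subgroup `Π_Ÿ(Π) ∩ J ⊴ J` of INFINITE index (Rmk. 1.4.1 (ii), p. 28:
`Gal(Ÿ/X̲̲) ↠ l·ℤ`), so its injectivity (the field `ThetaEvaluation.inclHd_injective` of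
`ConstantMultipleRigidity.lean` at the model) is not formal; it is this lemma applied to the input
"`(l·Δ_Θ)(Π)` has no nontrivial element fixed by an open subgroup" (finitely many roots of unity in a
finite extension of `k`). Nothing here asserts any statement of [EtTh] or [IUTchII].
Seat abc-iut-w4-d041 (D-0067 wave 4).
-/

namespace Literature.AnabelianGeometry.EtaleTheta

open scoped IsMulCommutative

namespace ContH1

variable {G G' : Type*} [Group G] [TopologicalSpace G]
  [Group G'] [TopologicalSpace G'] [IsTopologicalGroup G']
  {φ : G →* G'} {A : Subgroup G'} [A.Normal] [IsMulCommutative A]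

/-- **Restriction to a normal subgroup without fixed points is injective in degree one**: if `N ≤ H`
is normal in `H` and the only element of `A` fixed by (the conjugation action through `φ` of) every
element of `N` is `1`, then `res : H¹(H, A) → H¹(N, A)` is injective. (Corollary of the
inflation–restriction sequence `0 → H¹(H/N, A^N) → H¹(H, A) → H¹(N, A)`.)
[cite: NeukirchSchmidtWingberg2008, I §6] -/
theorem res_injective_of_forall_fixed_eq_one {N H : Subgroup G} (hNH : N ≤ H)
    (hnorm : (N.subgroupOf H).Normal)
    (hfix : ∀ a : A, (∀ n : G, n ∈ N → MulAut.conjNormal (φ n) a = a) → a = 1) :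
    Function.Injective (ContH1.res φ A hNH) := by
  rw [injective_iff_map_eq_one]
  intro x hx
  induction x using QuotientGroup.induction_on with
  | H f =>
    have hfx : (QuotientGroup.mk (ContH1.resCocycle φ A hNH f) :
        contCocycles φ A N ⧸ (contCoboundaries φ A N).subgroupOf (contCocycles φ A N)) = 1 := hx
    rw [QuotientGroup.eq_one_iff, Subgroup.mem_subgroupOf] at hfx
    obtain ⟨a, ha⟩ := (mem_contCoboundaries_iff _).mp hfx
    change (QuotientGroup.mk f :
        contCocycles φ A H ⧸ (contCoboundaries φ A H).subgroupOf (contCocycles φ A H)) = 1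
    rw [QuotientGroup.eq_one_iff, Subgroup.mem_subgroupOf]
    refine (mem_contCoboundaries_iff _).mpr ⟨a, ?_⟩
    -- the cocycle identity of `f` and its values on `N`
    have hcoc : ∀ g h : H, f.1 (g * h) = f.1 g * MulAut.conjNormal (φ (g : G)) (f.1 h) := f.2.2
    have hfN : ∀ n : H, (n : G) ∈ N →
        f.1 n = MulAut.conjNormal (φ (n : G)) a * a⁻¹ := by
      intro n hn
      have := congrFun ha ⟨n.1, hn⟩
      simpa [ContH1.resCocycle] using this
    funext h
    -- `b := a · f(h) · (ʰa)⁻¹` is fixed by every `m ∈ N`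
    have hb : ∀ m : G, m ∈ N → MulAut.conjNormal (φ m)
        (a * f.1 h * (MulAut.conjNormal (φ (h : G)) a)⁻¹) =
        a * f.1 h * (MulAut.conjNormal (φ (h : G)) a)⁻¹ := by
      intro m hm
      have hmH : m ∈ H := hNH hm
      -- `n' := h⁻¹ m h ∈ N` (normality) and `m h = h n'`
      have hn' : ((h⁻¹ * ⟨m, hmH⟩ * h : H) : G) ∈ N := by
        have := hnorm.conj_mem ⟨m, hmH⟩ (Subgroup.mem_subgroupOf.mpr hm) h⁻¹
        rw [inv_inv] at this
        exact Subgroup.mem_subgroupOf.mp this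
      have e3 : (⟨m, hmH⟩ : H) * h = h * (h⁻¹ * ⟨m, hmH⟩ * h) := by group
      have e3' : (h : G) * ((h⁻¹ * ⟨m, hmH⟩ * h : H) : G) = m * (h : G) := by
        show (h : G) * ((h : G)⁻¹ * m * (h : G)) = m * (h : G)
        group
      -- the two expansions of `f (m h) = f (h n')`
      have e1 : f.1 (⟨m, hmH⟩ * h) = MulAut.conjNormal (φ m) a * a⁻¹ *
          MulAut.conjNormal (φ m) (f.1 h) := by
        rw [hcoc, hfN ⟨m, hmH⟩ hm]
      have e2 : f.1 (h * (h⁻¹ * ⟨m, hmH⟩ * h)) = f.1 h *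
          (MulAut.conjNormal (φ (h : G)) (MulAut.conjNormal (φ ((h⁻¹ * ⟨m, hmH⟩ * h : H) : G)) a) *
            (MulAut.conjNormal (φ (h : G)) a)⁻¹) := by
        rw [hcoc, hfN _ hn', map_mul, map_inv]
      have e4 : MulAut.conjNormal (φ (h : G)) (MulAut.conjNormal (φ ((h⁻¹ * ⟨m, hmH⟩ * h : H) : G)) a) =
          MulAut.conjNormal (φ m) (MulAut.conjNormal (φ (h : G)) a) := by
        rw [← MulAut.mul_apply, ← map_mul, ← map_mul, e3', map_mul, map_mul, MulAut.mul_apply]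
      rw [e3, e2, e4] at e1
      -- `e1 : f h * (σm (σh a) * (σh a)⁻¹) = σm a * a⁻¹ * σm (f h)`; conclude in the abelian group `A`
      have key := congrArg Additive.ofMul e1
      apply Additive.ofMul.injective
      simp only [map_mul, map_inv, ofMul_mul, ofMul_inv] at key ⊢
      rw [← sub_eq_zero] at key ⊢
      have key' := neg_eq_zero.mpr key
      convert key' using 1
      abel
    have hb1 := hfix _ hb
    -- `a · f(h) · (ʰa)⁻¹ = 1` gives `f(h) = ʰa · a⁻¹`
    have key := congrArg Additive.ofMul hb1
    apply Additive.ofMul.injective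
    simp only [ofMul_mul, ofMul_inv, ofMul_one] at key ⊢
    rw [← sub_eq_zero]
    convert key using 1
    abel

/-- The same with `N` normal in the ambient group `G` (e.g. `Π_Ÿ(Π) ∩ J` for normal open `J ⊴ Π` and
the Galois covering `Ÿ → X̲̲`). [cite: NeukirchSchmidtWingberg2008, I §6] -/
theorem res_injective_of_forall_fixed_eq_one' {N H : Subgroup G} [hN : N.Normal] (hNH : N ≤ H)
    (hfix : ∀ a : A, (∀ n : G, n ∈ N → MulAut.conjNormal (φ n) a = a) → a = 1) :
    Function.Injective (ContH1.res φ A hNH) :=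
  res_injective_of_forall_fixed_eq_one hNH (hN.subgroupOf H) hfix

end ContH1

end Literature.AnabelianGeometry.EtaleTheta
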